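import Mathlib

/-!
# The shared-hub mechanism `H5`: a second way the vdBHK (2006) mixed-graph conjecture fails
(blind cell PercRepro2, lead)

`BHKMixedCoreGeneral.lean` (this cell) proves that on the four-vertex core `s ⇄ x`, `t ⇄ y`,
`{x, y}` the conditional covariance of `f = 1[x ∈ V(C_s)]` and `g = 1[y ∉ V(C_t)]` given
`Q = {V(C_s) ∩ V(C_t) = ∅}` has the closed form `A(1−A)·B(1−B)·E·[(1−A')(1−B') − (1−E)·A'B']`, so
that it is negative exactly when the RETURN arcs `x → s`, `y → t` are strong enough.  This file
records a DIFFERENT five-vertex mechanism, with NO return arcs: a shared hub `h = 4` with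
`x → h`, `y → h`, `h → s`, `h → t`.  The hub can be reached from either side and leads to BOTH
roots, so `Q` forbids either cluster to reach it, and «reaching the forbidden hub» plays the
role of the return.  Vertices `s = 0`, `t = 1`, `x = 2`, `y = 3`, `h = 4`; the seven edges
`s → x (a)`, `t → y (b)`, `{x, y} (e)`, `x → h (c)`, `y → h (d)`, `h → s (r)`, `h → t (q)` are
open independently with these probabilities; the root-inclusive convention `v ∈ V(C_v)` is used
throughout (as in `BHKMixedCoreGeneral.lean`).

Main statements (all sums are over the `2^7` configurations, reachability by `decide`, the
identities closed by `ring`):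

* `covariance_numerator`:  `M_Q · M_fg − M_f · M_g = a(1−a) · b(1−b) · R(e, c, d, r, q)` with the
  explicit 20-term residual `R` (`hubResidual`); the chain weights `a, b` factor out exactly as in
  the core, the sign is decided by the edge `{x, y}`, the two hub arcs and the two hub returns;
* `covariance_neg_iff`: for weights in `(0, 1)` the conditional covariance is negative iff `R < 0`;
* `uniform_half_positive`: at every weight `1/2` the numerator is `57/4096 > 0`;
* `hub_point_negative`: at `a = b = c = d = 7/8`, `e = 3/4`, `r = q = 1023/1024` it is negative
  (`R = −139648391/68719476736`, conditional covariance `−6842771159/224801153424 ≈ −0.0304`).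

So the mixed-graph conjecture also fails on systems containing no return arc at all — the
mechanism is not the `K4` core in disguise: no separated two-sided sub-system exists here.
-/

namespace Summit.Ventures.PercRepro2.BHKMixedHub5

/-- An edge of a mixed graph: `arc = true` is the arc `u → v`, `arc = false` the undirected edge
`{u, v}`. -/
structure MEdge where
  arc : Bool
  u : Nat
  v : Nat

/-- The seven edges of `H5`: `0 = s → x`, `1 = t → y`, `2 = {x, y}`, `3 = x → h`, `4 = y → h`,
`5 = h → s`, `6 = h → t`. -/
def edge : Nat → MEdge
  | 0 => ⟨true,  0, 2⟩
  | 1 => ⟨true,  1, 3⟩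
  | 2 => ⟨false, 2, 3⟩
  | 3 => ⟨true,  2, 4⟩
  | 4 => ⟨true,  3, 4⟩
  | 5 => ⟨true,  4, 0⟩
  | _ => ⟨true,  4, 1⟩

/-- Edge `i` is open in the configuration `c ∈ [0, 128)` iff bit `i` of `c` is set. -/
def isOpen (c i : Nat) : Bool := c.testBit i

/-- Vertex sets are bitmasks over `0..4`. -/
def mem (S x : Nat) : Bool := S.testBit x

/-- One expansion step along the open edges (arcs forward, the undirected edge both ways). -/
def step (c S : Nat) : Nat :=
  (List.range 7).foldl (fun S i =>
    let e := edge i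
    if isOpen c i then
      let S₁ := if mem S e.u then S ||| (1 <<< e.v) else S
      if e.arc then S₁ else (if mem S₁ e.v then S₁ ||| (1 <<< e.u) else S₁)
    else S) S

/-- `n`-fold iteration of `step c`. -/
def iter (c : Nat) : Nat → Nat → Nat
  | 0, S => S
  | n + 1, S => iter c n (step c S)

/-- `V(C_v)` root-inclusively: the vertices reachable from `v` by open oriented paths
(`v` included); five steps suffice on five vertices. -/
def reach (c v : Nat) : Nat := iter c 5 (1 <<< v)

/-- `Q = {V(C_s) ∩ V(C_t) = ∅}`. -/
def Q (c : Nat) : Bool := (reach c 0 &&& reach c 1) == 0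
/-- `f = 1[x ∈ V(C_s)]`. -/
def f (c : Nat) : Bool := mem (reach c 0) 2
/-- `g = 1[y ∉ V(C_t)]`. -/
def g (c : Nat) : Bool := !(mem (reach c 1) 3)

/-- Product Bernoulli weight of the configuration `n` with the seven weights
`a, b, e, c, d, r, q` in the order of `edge`. -/
def wt (a b e c d r q : ℚ) (n : Nat) : ℚ :=
  (if isOpen n 0 then a else 1 - a) * (if isOpen n 1 then b else 1 - b) *
    (if isOpen n 2 then e else 1 - e) * (if isOpen n 3 then c else 1 - c) *
    (if isOpen n 4 then d else 1 - d) * (if isOpen n 5 then r else 1 - r) *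
    (if isOpen n 6 then q else 1 - q)

/-- `P(Q)`. -/
def massQ (a b e c d r q : ℚ) : ℚ :=
  ∑ n ∈ Finset.range 128, if Q n then wt a b e c d r q n else 0
/-- `E[f; Q]`. -/
def massfQ (a b e c d r q : ℚ) : ℚ :=
  ∑ n ∈ Finset.range 128, if Q n && f n then wt a b e c d r q n else 0
/-- `E[g; Q]`. -/
def massgQ (a b e c d r q : ℚ) : ℚ :=
  ∑ n ∈ Finset.range 128, if Q n && g n then wt a b e c d r q n else 0
/-- `E[fg; Q]`. -/
def massfgQ (a b e c d r q : ℚ) : ℚ :=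
  ∑ n ∈ Finset.range 128, if Q n && f n && g n then wt a b e c d r q n else 0

/-- The residual `R(e, c, d, r, q)` of the hub numerator. -/
def hubResidual (e c d r q : ℚ) : ℚ :=
  e + c * d - c * d * q - c * d * r - e * d * q - e * d * r - e * c * q - e * c * r - e * c * d
    + c * d * r * q + 2 * e * c * d * q + 2 * e * c * d * r + e * d ^ 2 * r * q + e * c ^ 2 * r * q
    - e * c * d ^ 2 * r * q - e * c ^ 2 * d * r * q + e ^ 2 * c * d * r * q - e ^ 2 * c * d ^ 2 * r * q
    - e ^ 2 * c ^ 2 * d * r * q + e ^ 2 * c ^ 2 * d ^ 2 * r * q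

set_option maxRecDepth 65536

/-- `P(Q)` as a polynomial. -/
theorem massQ_eq (a b e c d r q : ℚ) :
    massQ a b e c d r q =
      1 - b * d * r - a * c * q - a * b * e - b * e * c * r - a * e * d * q - a * b * c * d
        + b * e * c * d * r + a * e * c * d * q + a * b * c * d * q + a * b * c * d * r
        + a * b * e * d * q + a * b * e * d * r + a * b * e * c * q + a * b * e * c * r
        + a * b * e * c * d - 2 * a * b * e * c * d * q - 2 * a * b * e * c * d * r := by
  simp (config := {decide := true}) [massQ, Finset.sum_range_succ, wt, isOpen, Q]
  ring

/-- `E[f; Q]` as a polynomial. -/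
theorem massfQ_eq (a b e c d r q : ℚ) :
    massfQ a b e c d r q =
      a - a * c * q - a * b * e - a * e * d * q - a * b * d * r - a * b * c * d
        + a * e * c * d * q + a * b * c * d * q + a * b * c * d * r + a * b * e * d * q
        + a * b * e * d * r + a * b * e * c * q + a * b * e * c * d
        - 2 * a * b * e * c * d * q - a * b * e * c * d * r := by
  simp (config := {decide := true}) [massfQ, Finset.sum_range_succ, wt, isOpen, Q, f]
  ring

/-- `E[g; Q]` as a polynomial. -/
theorem massgQ_eq (a b e c d r q : ℚ) :
    massgQ a b e c d r q =
      1 - b - a * c * q - a * e * d * q + a * b * c * q + a * e * c * d * q + a * b * e * d * q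
        - a * b * e * c * d * q := by
  simp (config := {decide := true}) [massgQ, Finset.sum_range_succ, wt, isOpen, Q, g]
  ring

/-- `E[fg; Q]` as a polynomial. -/
theorem massfgQ_eq (a b e c d r q : ℚ) :
    massfgQ a b e c d r q =
      a - a * b - a * c * q - a * e * d * q + a * b * c * q + a * e * c * d * q + a * b * e * d * q
        - a * b * e * c * d * q := by
  simp (config := {decide := true}) [massfgQ, Finset.sum_range_succ, wt, isOpen, Q, f, g]
  ring

/-- THE CLOSED FORM of the hub mechanism:
`M_Q · M_fg − M_f · M_g = a(1−a) · b(1−b) · R(e, c, d, r, q)`. -/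
theorem covariance_numerator (a b e c d r q : ℚ) :
    massQ a b e c d r q * massfgQ a b e c d r q - massfQ a b e c d r q * massgQ a b e c d r q =
      a * (1 - a) * (b * (1 - b)) * hubResidual e c d r q := by
  rw [massQ_eq, massfQ_eq, massgQ_eq, massfgQ_eq, hubResidual]; ring

/-- Each configuration weight is non-negative for weights in `[0, 1]`. -/
theorem wt_nonneg (a b e c d r q : ℚ) (ha : 0 ≤ a) (ha1 : a ≤ 1) (hb : 0 ≤ b) (hb1 : b ≤ 1)
    (he : 0 ≤ e) (he1 : e ≤ 1) (hc : 0 ≤ c) (hc1 : c ≤ 1) (hd : 0 ≤ d) (hd1 : d ≤ 1)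
    (hr : 0 ≤ r) (hr1 : r ≤ 1) (hq : 0 ≤ q) (hq1 : q ≤ 1) (n : Nat) :
    0 ≤ wt a b e c d r q n := by
  unfold wt
  repeat' apply mul_nonneg
  all_goals (split_ifs <;> linarith)

/-- `P(Q) > 0` for weights in `(0, 1)`: the all-closed configuration alone has positive weight. -/
theorem massQ_pos (a b e c d r q : ℚ) (ha : 0 < a) (ha1 : a < 1) (hb : 0 < b) (hb1 : b < 1)
    (he : 0 < e) (he1 : e < 1) (hc : 0 < c) (hc1 : c < 1) (hd : 0 < d) (hd1 : d < 1)
    (hr : 0 < r) (hr1 : r < 1) (hq : 0 < q) (hq1 : q < 1) :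
    0 < massQ a b e c d r q := by
  have h0 : (if Q 0 then wt a b e c d r q 0 else 0) ≤ massQ a b e c d r q := by
    unfold massQ
    apply Finset.single_le_sum (f := fun n => if Q n then wt a b e c d r q n else 0)
    · intro n _
      split_ifs
      · exact wt_nonneg a b e c d r q ha.le ha1.le hb.le hb1.le he.le he1.le hc.le hc1.le hd.le
          hd1.le hr.le hr1.le hq.le hq1.le n
      · exact le_rfl
    · simp
  have h1 : (if Q 0 then wt a b e c d r q 0 else 0)
      = (1 - a) * (1 - b) * (1 - e) * (1 - c) * (1 - d) * (1 - r) * (1 - q) := by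
    simp (config := {decide := true}) [wt]
  have h2 : 0 < (1 - a) * (1 - b) * (1 - e) * (1 - c) * (1 - d) * (1 - r) * (1 - q) := by
    repeat' apply mul_pos
    all_goals linarith
  linarith

/-- The sign rule of the hub mechanism: for weights in `(0, 1)` the conditional covariance is
negative iff the residual `R(e, c, d, r, q)` is negative. -/
theorem covariance_neg_iff (a b e c d r q : ℚ) (ha : 0 < a) (ha1 : a < 1) (hb : 0 < b) (hb1 : b < 1)
    (he : 0 < e) (he1 : e < 1) (hc : 0 < c) (hc1 : c < 1) (hd : 0 < d) (hd1 : d < 1)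
    (hr : 0 < r) (hr1 : r < 1) (hq : 0 < q) (hq1 : q < 1) :
    massfgQ a b e c d r q / massQ a b e c d r q
        < (massfQ a b e c d r q / massQ a b e c d r q) * (massgQ a b e c d r q / massQ a b e c d r q)
      ↔ hubResidual e c d r q < 0 := by
  have hQ : 0 < massQ a b e c d r q :=
    massQ_pos a b e c d r q ha ha1 hb hb1 he he1 hc hc1 hd hd1 hr hr1 hq hq1
  have hpos : 0 < a * (1 - a) * (b * (1 - b)) :=
    mul_pos (mul_pos ha (by linarith)) (mul_pos hb (by linarith))
  have hcov : massfgQ a b e c d r q / massQ a b e c d r q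
      - (massfQ a b e c d r q / massQ a b e c d r q) * (massgQ a b e c d r q / massQ a b e c d r q)
      = (massQ a b e c d r q * massfgQ a b e c d r q - massfQ a b e c d r q * massgQ a b e c d r q)
          / (massQ a b e c d r q * massQ a b e c d r q) := by
    field_simp
  rw [← sub_neg, hcov, div_lt_iff₀ (mul_pos hQ hQ), zero_mul, covariance_numerator]
  constructor
  · intro h
    rcases mul_neg_iff.1 h with ⟨_, hb'⟩ | ⟨ha', _⟩
    · exact hb'
    · linarith
  · intro h
    exact mul_neg_of_pos_of_neg hpos h

/-- At every weight `1/2` the numerator is `57/4096 > 0`: the hub mechanism is not sign-definite. -/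
theorem uniform_half_positive :
    0 < massQ (1/2) (1/2) (1/2) (1/2) (1/2) (1/2) (1/2) * massfgQ (1/2) (1/2) (1/2) (1/2) (1/2) (1/2) (1/2)
        - massfQ (1/2) (1/2) (1/2) (1/2) (1/2) (1/2) (1/2) * massgQ (1/2) (1/2) (1/2) (1/2) (1/2) (1/2) (1/2) := by
  rw [covariance_numerator, hubResidual]; norm_num

/-- With the hub returns nearly deterministic (`r = q = 1023/1024`), `a = b = c = d = 7/8` and
`e = 3/4`, the conditional covariance is NEGATIVE (`R = −139648391/68719476736`,
covariance `−6842771159/224801153424`): a failure of the mixed-graph conjecture with no return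
arc in the system. -/
theorem hub_point_negative :
    massfgQ (7/8) (7/8) (3/4) (7/8) (7/8) (1023/1024) (1023/1024)
        / massQ (7/8) (7/8) (3/4) (7/8) (7/8) (1023/1024) (1023/1024)
      < (massfQ (7/8) (7/8) (3/4) (7/8) (7/8) (1023/1024) (1023/1024)
            / massQ (7/8) (7/8) (3/4) (7/8) (7/8) (1023/1024) (1023/1024))
          * (massgQ (7/8) (7/8) (3/4) (7/8) (7/8) (1023/1024) (1023/1024)
            / massQ (7/8) (7/8) (3/4) (7/8) (7/8) (1023/1024) (1023/1024)) := by
  rw [covariance_neg_iff] <;> norm_num [hubResidual]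

end Summit.Ventures.PercRepro2.BHKMixedHub5
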